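import Literature.Analysis.FluidPDE.PalasekQuantitativeAxisym
import Literature.Analysis.FluidPDE.TaoSection6Reduction
import HarnessLib

/-!
# Palasek 2021, Thm 1 (`q = 3`, axisymmetric): reduction to unit time and to the main estimate

Analysis/FluidPDE proof file (theorems only, no definitions, no named facts), first steps of the
inline programme for the named fact
`Literature.Analysis.FluidPDE.palasek2021_axisym_quantitative_ess` (`PalasekQuantitativeAxisym.lean`;
S. Palasek, *Improved quantitative regularity for the Navier–Stokes equations in a scale of
critical spaces*, Arch. Ration. Mech. Anal. 242 (2021) 1479–1531 = arXiv:2101.08586, **Thm 1** in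
the case `q = 3`, `u` axisymmetric, `j = 0, 1`).

The printed proof of Thm 1 (§5, after Prop 11, arXiv p. 47) reads:

> "Once again, we can roughly follow [tao] … By increasing `A`, we can make `A ≥ C₀`. By rescaling,
> it suffices to prove the theorem with `t = 1`. Proposition 11 [the main estimate:
> `|P_{N₀}u(t₀,x₀)| ≥ A₁⁻¹N₀ ⟹ TN₀² ≤ exp exp(A₆^{O(1)})`] implies that
> `‖P_N u‖_{L^∞_{t,x}([1/2,1] × ℝ³)} ≤ A₁⁻¹N` whenever `N ≥ N_*`, where `N_* = exp exp(A₇)`. We apply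
> the decomposition `u = ů_n + ũ_n` on `[0, 1]` … `E(t) = ½∫|ũ_n|²` … From here one proceeds to
> estimate `Y₄` and conclude exactly as in [tao]."

At `q = 3` the weight `r^{1-3/q}` is `1`, so Palasek's hypothesis (critical) is *literally* Tao's
`‖u‖_{L^∞_t L³_x} ≤ A`, and the energy method "exactly as in [tao]" is Tao's §6, which the tree has
proved once and for all from the high-frequency smallness (6.1) with `N_* = 2^J`
(`section6_bounds_of_isHkClassicalSolutionOn`, `TaoSection6Final.lean`; it does not see the
symmetry). This file therefore carries out, for the axisymmetric fact and its double exponential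
`palasekDoubleExp C A = exp exp(A^C)`, exactly the two reductions the tree performed for
`tao_quantitative_ess` (`TaoQuantitativeReduction.lean`, `TaoSection6Reduction.lean`):

* `palasekDoubleExp_mono`, `one_le_palasekDoubleExp`, `palasekDoubleExp_absorb` — bookkeeping:
  `exp exp(A^C)` is monotone in `C` and absorbs polynomial prefactors,
  `K A^m (exp exp(A^C))^m ≤ exp exp(A^{C+1})` for `A ≥ max(2, log K, 2m+1)`, `C ≥ 1`
  (Palasek's "`exp exp(A^{O(1)})`", §2.1: constants depend only on `q`, here fixed `q = 3`);
* `IsAxisymmetric.nsRescale_slice` — axisymmetry is invariant under the Navier–Stokes scaling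
  `u ↦ c u(c²·, c·)` (rotations about the axis are linear);
* `palasek2021_axisym_quantitative_ess_of_unit_time`, `…_iff_unit_time` — **"By rescaling, it
  suffices to prove the theorem with `t = 1`"** (and "by increasing `A`", an arbitrary threshold
  `A ≥ A₀`): restrict to `[0, t]` (`IsHkClassicalSolutionOn.mono`), rescale by `c = √t`
  (`IsHkClassicalSolutionOn.nsRescale`, `eLpNorm_nsRescale_three`, `IsAxisymmetric.nsRescale_slice`),
  undo the scaling (`u(t,x) = c⁻¹u_c(1,c⁻¹x)`, `∇u(t,x) = c⁻²∇u_c(1,c⁻¹x)`);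
* `palasek2021_axisym_quantitative_ess_of_main_estimate` — **Thm 1 (`q = 3`) from Prop 11
  (`q = 3`)**: if the main estimate holds for axisymmetric solutions of Tao's class with a DOUBLE
  exponential (`|Δ̇_j u(T,x₀)| ≥ A^{-c₁}2^j ⟹ T4^j ≤ exp exp(A^{C₇})`, the Littlewood–Paley
  projection rendered by the tree's block `Δ̇_j = blockFn j`, `N₀ = 2^j`, as in
  `tao_quantitative_ess_of_main_estimate`), then `palasek2021_axisym_quantitative_ess`: the
  contrapositive of the main estimate on `[0, t]`, `t ∈ [1/2, 1]`, gives (6.1) above the dyadic scale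
  `2^J ≈ max(ΛA, 2N_*^{1/2})`, the tree's §6 gives `|u(1,x)|, |∇u(1,x)| ≤ C(A2^J)^e`, and the double
  exponential absorbs the polynomial.

What remains of the named fact after this file is exactly Palasek's Prop 11 in the case `q = 3`,
`u` axisymmetric (the hypothesis of `palasek2021_axisym_quantitative_ess_of_main_estimate`), whose
printed proof uses Props 1–10 of the paper (weighted/axisymmetric Bernstein inequalities, the
Picard-iterate decomposition, epochs of regularity, bounded total speed, back propagation,
regularity away from the axis, and the two Carleman inequalities) — the analogue of Tao's Thm 5.1,
which is likewise what remains of `tao_quantitative_ess` in the tree. No new named fact is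
introduced here (D-0026): Prop 11 enters only as the explicit hypothesis of a proved implication.

## Mathlib / tree search

Tree: `tao_quantitative_ess_of_unit_time`, `IsHkClassicalSolutionOn.nsRescale`,
`eLpNorm_nsRescale_three`, `preimage_mul_Icc_eq_unit` (`TaoQuantitativeReduction.lean`);
`section6_bounds_of_isHkClassicalSolutionOn` (`TaoSection6Final.lean`);
`tao_quantitative_ess_of_main_estimate`, `taoTripleExp_absorb` (`TaoSection6Reduction.lean`, the
model for this file); `palasekDoubleExp`, `palasekDoubleExp_def` (`PalasekQuantitativeAxisym.lean`);
`rotZ`, `IsAxisymmetric` (`AxisymmetricEuler.lean`; the linearity `rotZ θ (a • y) = a • rotZ θ y` is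
`rotZ_smul` of `EulerTimeScaling.lean`, re-proved privately here to keep the imports inside the
Tao programme). Mathlib: `fderiv_const_smul`, `fderiv_comp_smul`, `Real.rpow_logb`, `Int.le_ceil`.

## References

* S. Palasek, *Improved quantitative regularity for the Navier–Stokes equations in a scale of
  critical spaces*, Arch. Ration. Mech. Anal. 242 (2021), 1479–1531 (arXiv:2101.08586): Thm 1 and
  Rmk 1, p. 4; §2.1 (conventions: `A ≥ 2`, constants depending on `q` only); Prop 11 and the proof
  of Thm 1, §5. [Palasek2021]
* T. Tao, *Quantitative bounds for critically bounded solutions to the Navier–Stokes equations*,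
  Proc. Sympos. Pure Math. 104 (2021), 149–193 (arXiv:1908.04958v2): §6, pp. 41–43 (the energy
  method Palasek quotes). [Tao2021QuantitativeNS]
-/

noncomputable section

open MeasureTheory Set Function Filter Topology
open Literature.Analysis.FunctionSpaces
open scoped ENNReal NNReal

namespace Literature.Analysis.FluidPDE

local notation "ℝ³" => EuclideanSpace ℝ (Fin 3)

/-! ## The double exponential -/

section DoubleExp

/-- `exp exp(A^C)` is monotone in `C` for `A ≥ 1`. [folklore] -/
theorem palasekDoubleExp_mono {A C C' : ℝ} (hA : 1 ≤ A) (hC : C ≤ C') :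
    palasekDoubleExp C A ≤ palasekDoubleExp C' A := by
  rw [palasekDoubleExp_def, palasekDoubleExp_def]
  exact Real.exp_le_exp.2 (Real.exp_le_exp.2 (Real.rpow_le_rpow_of_exponent_le hA hC))

/-- `1 ≤ exp exp(A^C)`. [folklore] -/
theorem one_le_palasekDoubleExp (C A : ℝ) : 1 ≤ palasekDoubleExp C A := by
  rw [palasekDoubleExp_def]; exact Real.one_le_exp (Real.exp_pos _).le

/-- **The double exponential absorbs polynomial prefactors** (Palasek's
"`N_*^{O(1)} ≤ exp exp(A^{O(1)})`", the constants depending only on `q = 3`, §2.1): for `K > 0`,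
`m : ℕ`, `C ≥ 1` and `A ≥ max(2, log K, 2m + 1)`:
`K A^m (exp exp(A^C))^m ≤ exp exp(A^{C+1})`. With `E₁ = exp(A^C)`: the left side is at most
`exp((2m+1)E₁) ≤ exp(E₁²) = exp(exp(2A^C)) ≤ exp(exp(A^{C+1}))`. [cite: Palasek2021, §2.1 and §5 (proof of Thm 1)] -/
theorem palasekDoubleExp_absorb {K : ℝ} (hK : 0 < K) (m : ℕ) {C A : ℝ} (hC : 1 ≤ C)
    (hA2 : 2 ≤ A) (hAK : Real.log K ≤ A) (hAm : (2 * m + 1 : ℝ) ≤ A) :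
    K * A ^ m * palasekDoubleExp C A ^ m ≤ palasekDoubleExp (C + 1) A := by
  have hA1 : 1 ≤ A := by linarith only [hA2]
  have hA0 : 0 ≤ A := by linarith only [hA2]
  obtain ⟨y, hy⟩ : ∃ y : ℝ, y = A ^ C := ⟨_, rfl⟩
  have hAy : A ≤ y := by
    rw [hy]
    calc A = A ^ (1 : ℝ) := (Real.rpow_one A).symm
      _ ≤ A ^ C := Real.rpow_le_rpow_of_exponent_le hA1 hC
  obtain ⟨E₁, hE₁⟩ : ∃ E₁ : ℝ, E₁ = Real.exp y := ⟨_, rfl⟩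
  have hyE₁ : y ≤ E₁ := by rw [hE₁]; linarith only [Real.add_one_le_exp y]
  have hAE₁ : A ≤ E₁ := hAy.trans hyE₁
  have hT : palasekDoubleExp C A = Real.exp E₁ := by rw [palasekDoubleExp_def, ← hy, ← hE₁]
  -- `K ≤ exp E₁`, `A^m ≤ exp(m E₁)`, `T^m = exp(m E₁)`
  have hK' : K ≤ Real.exp E₁ := by
    calc K = Real.exp (Real.log K) := (Real.exp_log hK).symm
      _ ≤ Real.exp E₁ := Real.exp_le_exp.2 (hAK.trans hAE₁)
  have hAm' : A ^ m ≤ Real.exp (m * E₁) := by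
    calc A ^ m ≤ E₁ ^ m := pow_le_pow_left₀ hA0 hAE₁ m
      _ ≤ (Real.exp E₁) ^ m :=
          pow_le_pow_left₀ (hA0.trans hAE₁) (by linarith only [Real.add_one_le_exp E₁]) m
      _ = Real.exp (m * E₁) := by rw [← Real.exp_nat_mul]
  have hTm : palasekDoubleExp C A ^ m = Real.exp (m * E₁) := by rw [hT, ← Real.exp_nat_mul]
  have hlhs : K * A ^ m * palasekDoubleExp C A ^ m ≤ Real.exp ((2 * m + 1) * E₁) := by
    calc K * A ^ m * palasekDoubleExp C A ^ m
        ≤ Real.exp E₁ * Real.exp (m * E₁) * Real.exp (m * E₁) := by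
          rw [hTm]
          gcongr
      _ = Real.exp ((2 * m + 1) * E₁) := by
          rw [← Real.exp_add, ← Real.exp_add]; congr 1; ring
  -- `(2m+1) E₁ ≤ E₁² = exp(2y) ≤ exp(A^{C+1})`
  have h2m : (2 * m + 1 : ℝ) ≤ E₁ := hAm.trans hAE₁
  have hE₁0 : 0 ≤ E₁ := by linarith only [hA0, hAE₁]
  have hstep1 : (2 * m + 1 : ℝ) * E₁ ≤ Real.exp (2 * y) := by
    calc (2 * m + 1 : ℝ) * E₁ ≤ E₁ * E₁ := mul_le_mul_of_nonneg_right h2m hE₁0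
      _ = Real.exp (2 * y) := by rw [hE₁, ← Real.exp_add]; ring_nf
  have hstep2 : 2 * y ≤ A ^ (C + 1) := by
    rw [hy, Real.rpow_add_one (by linarith only [hA2] : A ≠ 0), mul_comm]
    exact mul_le_mul_of_nonneg_left hA2 (Real.rpow_nonneg hA0 C)
  calc K * A ^ m * palasekDoubleExp C A ^ m ≤ Real.exp ((2 * m + 1) * E₁) := hlhs
    _ ≤ Real.exp (Real.exp (A ^ (C + 1))) :=
        Real.exp_le_exp.2 (hstep1.trans (Real.exp_le_exp.2 hstep2))
    _ = palasekDoubleExp (C + 1) A := (palasekDoubleExp_def _ _).symm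

end DoubleExp

/-! ## Axisymmetry under the Navier–Stokes scaling -/

section Symmetry

/-- Rotations about the axis are linear: `R_θ (a y) = a R_θ y` (the tree's `rotZ_smul`,
`EulerTimeScaling.lean`, re-proved to keep the imports light). [folklore] -/
private theorem rotZ_smul_aux (θ a : ℝ) (y : ℝ³) : rotZ θ (a • y) = a • rotZ θ y := by
  ext i
  fin_cases i <;> simp <;> ring

/-- **Axisymmetry is scale invariant**: if the slice `u(c²s)` is axisymmetric then so is the slice
`(c u(c²·, c·))(s) = c u(c²s, c·)` of the rescaled field (Palasek 2021, §1: the conditions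
(critical)–(cases) are "critical with respect to the Navier–Stokes scaling"; rotations about the
axis commute with dilations). [cite: Palasek2021, §1 (scaling invariance of (critical)–(cases))] -/
theorem IsAxisymmetric.nsRescale_slice {u : ℝ → ℝ³ → ℝ³} {c s : ℝ}
    (h : IsAxisymmetric (u (c ^ 2 * s))) : IsAxisymmetric (FluidPDE.nsRescale c u s) := by
  intro θ y
  simp only [nsRescale_apply]
  rw [← rotZ_smul_aux θ c y, h θ (c • y), rotZ_smul_aux]

end Symmetry

/-! ## Reduction of Thm 1 (`q = 3`) to unit time -/

section UnitTime

/-- **Palasek 2021, Thm 1 (`q = 3`, axisymmetric) reduces to its case `T = t = 1` above any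
threshold `A ≥ A₀`** (§5, proof of Thm 1: "By increasing `A`, we can make `A ≥ C₀`. By rescaling,
it suffices to prove the theorem with `t = 1`"). Given the unit-time bounds
`|u(1, x)|, |∇u(1, x)| ≤ exp exp(A^C)` for axisymmetric Tao classical solutions on `[0, 1]` with
`‖u‖_{L^∞_t L³_x([0,1] × ℝ³)} ≤ A`, `A ≥ A₀`: choose `L ≥ 1` with `A₀ ≤ 2^L`; for a solution on
`[0, T]` with bound `A ≥ 2` and `0 < t ≤ T`, restrict to `[0, t]` (`IsHkClassicalSolutionOn.mono`),
rescale by `c = √t` to a solution on `[0, 1]` with the same `L³` bound and the same symmetry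
(`IsHkClassicalSolutionOn.nsRescale`, `eLpNorm_nsRescale_three`, `IsAxisymmetric.nsRescale_slice`),
apply the hypothesis with `A^L ≥ A₀` (`exp exp((A^L)^C) = exp exp(A^{LC})`), and undo the scaling:
`u(t, x) = c⁻¹u_c(1, c⁻¹x)`, `∇u(t, x) = c⁻²∇u_c(1, c⁻¹x)` with `c⁻¹ = t^{-1/2}`, `c⁻² = t⁻¹`. The
constant of the conclusion is `LC`. [cite: Palasek2021, §5 (proof of Thm 1: "By rescaling, it suffices to prove the theorem with t = 1")] -/
theorem palasek2021_axisym_quantitative_ess_of_unit_time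
    (h : ∃ A₀ C : ℝ, 0 < C ∧ ∀ (A : ℝ) (u : ℝ → ℝ³ → ℝ³) (p : ℝ → ℝ³ → ℝ),
      IsHkClassicalSolutionOn (Icc 0 1) u p →
      (∀ t ∈ Icc (0 : ℝ) 1, IsAxisymmetric (u t)) →
      (∀ t ∈ Icc (0 : ℝ) 1, eLpNorm (u t) 3 volume ≤ ENNReal.ofReal A) → A₀ ≤ A →
      ∀ x : ℝ³, ‖u 1 x‖ ≤ palasekDoubleExp C A ∧ ‖fderiv ℝ (u 1) x‖ ≤ palasekDoubleExp C A) :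
    palasek2021_axisym_quantitative_ess := by
  obtain ⟨A₀, C, hC, h⟩ := h
  -- an exponent `L ≥ 1` with `A₀ ≤ 2 ^ L`
  obtain ⟨L, hL1, hL⟩ : ∃ L : ℝ, 1 ≤ L ∧ A₀ ≤ 2 ^ L := by
    refine ⟨max 1 (Real.logb 2 (max A₀ 1)), le_max_left _ _, ?_⟩
    have h1 : (2 : ℝ) ^ Real.logb 2 (max A₀ 1) = max A₀ 1 :=
      Real.rpow_logb two_pos (by norm_num) (lt_of_lt_of_le one_pos (le_max_right _ _))
    calc A₀ ≤ max A₀ 1 := le_max_left _ _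
      _ = 2 ^ Real.logb 2 (max A₀ 1) := h1.symm
      _ ≤ 2 ^ max 1 (Real.logb 2 (max A₀ 1)) :=
        Real.rpow_le_rpow_of_exponent_le one_le_two (le_max_right _ _)
  refine ⟨L * C, mul_pos (one_pos.trans_le hL1) hC, ?_⟩
  intro T A u p hsol hax hL3 hA t ht x
  have ht0 : 0 < t := ht.1
  have hApos : 0 < A := two_pos.trans_le hA
  have hAL : A ≤ A ^ L := by
    calc A = A ^ (1 : ℝ) := (Real.rpow_one A).symm
      _ ≤ A ^ L := Real.rpow_le_rpow_of_exponent_le (one_le_two.trans hA) hL1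
  have hA₀ : A₀ ≤ A ^ L :=
    hL.trans (Real.rpow_le_rpow zero_le_two hA (zero_le_one.trans hL1))
  have hexp : palasekDoubleExp C (A ^ L) = palasekDoubleExp (L * C) A := by
    rw [palasekDoubleExp_def, palasekDoubleExp_def, ← Real.rpow_mul hApos.le]
  -- the scaling parameter `c = √t`
  obtain ⟨c, hc, hc2⟩ : ∃ c : ℝ, 0 < c ∧ c ^ 2 = t :=
    ⟨Real.sqrt t, Real.sqrt_pos.2 ht0, Real.sq_sqrt ht0.le⟩
  have hct : t ^ (-(1 / 2 : ℝ)) = c⁻¹ := by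
    rw [← hc2, show ((c ^ 2 : ℝ)) = c ^ (2 : ℝ) by norm_cast, ← Real.rpow_mul hc.le,
      show (2 : ℝ) * -(1 / 2) = -1 by norm_num, Real.rpow_neg_one]
  -- restrict to `[0, t]` and rescale to `[0, 1]`
  have hsol_t : IsHkClassicalSolutionOn (Icc 0 t) u p :=
    hsol.mono (Icc_subset_Icc_right ht.2) (uniqueDiffOn_Icc ht0)
  have hv_sol : IsHkClassicalSolutionOn (Icc 0 1) (FluidPDE.nsRescale c u)
      (nsRescalePressure c p) := by
    have := hsol_t.nsRescale hc
    rwa [preimage_mul_Icc_eq_unit hc2 ht0] at this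
  have hts : ∀ s ∈ Icc (0 : ℝ) 1, t * s ∈ Icc 0 T := fun s hs =>
    ⟨mul_nonneg ht0.le hs.1, (mul_le_of_le_one_right ht0.le hs.2).trans ht.2⟩
  have hv_ax : ∀ s ∈ Icc (0 : ℝ) 1, IsAxisymmetric (FluidPDE.nsRescale c u s) := by
    intro s hs
    refine IsAxisymmetric.nsRescale_slice ?_
    rw [hc2]
    exact hax (t * s) (hts s hs)
  have hv3 : ∀ s ∈ Icc (0 : ℝ) 1,
      eLpNorm (FluidPDE.nsRescale c u s) 3 volume ≤ ENNReal.ofReal (A ^ L) := by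
    intro s hs
    rw [eLpNorm_nsRescale_three u hc s, hc2]
    exact (hL3 (t * s) (hts s hs)).trans (ENNReal.ofReal_le_ofReal hAL)
  -- the unit-time statement for the rescaled solution at the point `c⁻¹ x`
  obtain ⟨k1, k2⟩ := h (A ^ L) (FluidPDE.nsRescale c u) (nsRescalePressure c p) hv_sol hv_ax hv3
    hA₀ (c⁻¹ • x)
  rw [hexp] at k1 k2
  -- undo the scaling
  have hv1 : FluidPDE.nsRescale c u 1 (c⁻¹ • x) = c • u t x := by
    simp only [nsRescale_apply, mul_one, hc2, smul_inv_smul₀ hc.ne']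
  have hdiff : Differentiable ℝ (u t) :=
    (hsol.1.contDiff_velocity ⟨ht0.le, ht.2⟩).differentiable (by simp)
  have hfd : fderiv ℝ (FluidPDE.nsRescale c u 1) (c⁻¹ • x) = (c ^ 2) • fderiv ℝ (u t) x := by
    have h1 : FluidPDE.nsRescale c u 1 = c • fun y => u t (c • y) := by
      funext y
      simp [nsRescale_apply, hc2]
    have hd : Differentiable ℝ (fun y => u t (c • y)) :=
      hdiff.comp (differentiable_id.const_smul c)
    rw [h1, fderiv_const_smul (hd _) c, fderiv_comp_smul, smul_inv_smul₀ hc.ne', smul_smul, sq]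
  constructor
  · have e : ‖u t x‖ = c⁻¹ * ‖FluidPDE.nsRescale c u 1 (c⁻¹ • x)‖ := by
      rw [hv1, norm_smul, Real.norm_eq_abs, abs_of_pos hc, ← mul_assoc, inv_mul_cancel₀ hc.ne',
        one_mul]
    rw [e, hct, mul_comm]
    exact mul_le_mul_of_nonneg_right k1 (inv_nonneg.2 hc.le)
  · have e : ‖fderiv ℝ (u t) x‖ = t⁻¹ * ‖fderiv ℝ (FluidPDE.nsRescale c u 1) (c⁻¹ • x)‖ := by
      rw [hfd, norm_smul, Real.norm_eq_abs, abs_of_pos (pow_pos hc 2), hc2, ← mul_assoc,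
        inv_mul_cancel₀ ht0.ne', one_mul]
    rw [e, Real.rpow_neg_one, mul_comm]
    exact mul_le_mul_of_nonneg_right k2 (inv_nonneg.2 ht0.le)

/-- **Thm 1 (`q = 3`, axisymmetric) ⇔ its unit-time case** (Palasek 2021, §5). The forward
direction is the specialisation `T = t = 1`, `A₀ = 2` (`1^{-1/2} = 1^{-1} = 1`); the converse is
`palasek2021_axisym_quantitative_ess_of_unit_time`. [cite: Palasek2021, §5 (proof of Thm 1)] -/
theorem palasek2021_axisym_quantitative_ess_iff_unit_time :
    palasek2021_axisym_quantitative_ess ↔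
      ∃ A₀ C : ℝ, 0 < C ∧ ∀ (A : ℝ) (u : ℝ → ℝ³ → ℝ³) (p : ℝ → ℝ³ → ℝ),
        IsHkClassicalSolutionOn (Icc 0 1) u p →
        (∀ t ∈ Icc (0 : ℝ) 1, IsAxisymmetric (u t)) →
        (∀ t ∈ Icc (0 : ℝ) 1, eLpNorm (u t) 3 volume ≤ ENNReal.ofReal A) → A₀ ≤ A →
        ∀ x : ℝ³, ‖u 1 x‖ ≤ palasekDoubleExp C A ∧ ‖fderiv ℝ (u 1) x‖ ≤ palasekDoubleExp C A := by
  refine ⟨fun ⟨C, hC, h⟩ => ⟨2, C, hC, fun A u p hsol hax hL3 hA x => ?_⟩,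
    palasek2021_axisym_quantitative_ess_of_unit_time⟩
  have := h 1 A u p hsol hax hL3 hA 1 ⟨one_pos, le_rfl⟩ x
  simpa using this

end UnitTime

/-! ## Thm 1 (`q = 3`) from the main estimate Prop 11 (`q = 3`) -/

section MainEstimate

/-- **Palasek 2021, Thm 1 (`q = 3`, axisymmetric) from the main estimate Prop 11 (`q = 3`,
axisymmetric).** Suppose the main estimate holds in the following form (Prop 11 with `t₀ = T` the
final time, `N₀ = 2^j`, `A₁⁻¹ = A^{-c₁}`, the Littlewood–Paley projection `P_{N₀}` rendered by the
block `Δ̇_j = blockFn j`, and `exp exp(A₆^{O(1)})` by `exp exp(A^{C₇})`): there are `A₀`, `c₁ > 0`,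
`C₇ > 0` such that for every solution `(u, p)` of Tao's class on `[0, T]`, `T > 0`, axisymmetric at
every time, with `‖u(t)‖₃ ≤ A` on `[0, T]` and `A ≥ A₀`, every `x₀` and every `j : ℤ`,
`|Δ̇_j u(T, x₀)| ≥ A^{-c₁} 2^j ⟹ T · 4^j ≤ exp exp(A^{C₇})`.
Then `palasek2021_axisym_quantitative_ess` holds. This is the printed proof of Thm 1 (§5): the
reduction to unit time, "Proposition 11 implies that `‖P_N u‖_{L^∞([1/2,1] × ℝ³)} ≤ A₁⁻¹N` whenever
`N ≥ N_* = exp exp(A₇)`" (the contrapositive on `[0, t]`, `t ∈ [1/2, 1]`), and the energy method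
"exactly as in [tao]" — at `q = 3` the hypothesis is Tao's `‖u‖_{L^∞_t L³_x} ≤ A`, so this is the
tree's §6 `section6_bounds_of_isHkClassicalSolutionOn` — followed by
`N_*^{O(1)} ≤ exp exp(A^{O(1)})` (`palasekDoubleExp_absorb`). [cite: Palasek2021, Prop 11 and proof of Thm 1, §5] -/
theorem palasek2021_axisym_quantitative_ess_of_main_estimate
    (hmain : ∃ A₀ c₁ C₇ : ℝ, 0 < c₁ ∧ 0 < C₇ ∧
      ∀ (T A : ℝ) (u : ℝ → ℝ³ → ℝ³) (p : ℝ → ℝ³ → ℝ),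
        IsHkClassicalSolutionOn (Icc 0 T) u p → 0 < T →
        (∀ t ∈ Icc 0 T, IsAxisymmetric (u t)) →
        (∀ t ∈ Icc 0 T, eLpNorm (u t) 3 volume ≤ ENNReal.ofReal A) → A₀ ≤ A →
        ∀ (x₀ : ℝ³) (j : ℤ),
          A ^ (-c₁) * (2 : ℝ) ^ j ≤ ‖blockFn j (u T) x₀‖ →
          T * (4 : ℝ) ^ j ≤ palasekDoubleExp C₇ A) :
    palasek2021_axisym_quantitative_ess := by
  obtain ⟨A₀, c₁, C₇, hc₁, hC₇, hmain⟩ := hmain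
  obtain ⟨κ₀, Λ, C₆, e, hκ₀, hΛ, hC₆, h6⟩ := section6_bounds_of_isHkClassicalSolutionOn
  -- w.l.o.g. `C₇ ≥ 1`
  obtain ⟨C₈, hC₈⟩ : ∃ C₈ : ℝ, C₈ = max C₇ 1 := ⟨_, rfl⟩
  have hC₈1 : 1 ≤ C₈ := by rw [hC₈]; exact le_max_right _ _
  have hC₇₈ : C₇ ≤ C₈ := by rw [hC₈]; exact le_max_left _ _
  -- the prefactor to be absorbed and the threshold
  obtain ⟨K, hK⟩ : ∃ K : ℝ, K = C₆ * (4 * Λ) ^ e := ⟨_, rfl⟩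
  have hKpos : 0 < K := by rw [hK]; positivity
  obtain ⟨Aκ, hAκ⟩ : ∃ Aκ : ℝ, Aκ = (κ₀⁻¹) ^ (1 / c₁) := ⟨_, rfl⟩
  obtain ⟨A₁, hA₁⟩ : ∃ A₁ : ℝ,
      A₁ = max (max (max A₀ 2) (max Aκ (Real.log K))) (2 * (2 * e : ℕ) + 1 : ℝ) := ⟨_, rfl⟩
  refine palasek2021_axisym_quantitative_ess_of_unit_time ⟨A₁, C₈ + 1, by linarith only [hC₈1], ?_⟩
  intro A u p hsol hax hA3 hA x
  -- unpacking the threshold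
  have hAA₀ : A₀ ≤ A := le_trans (by rw [hA₁]; simp) hA
  have hA2 : 2 ≤ A := le_trans (by rw [hA₁]; simp) hA
  have hAκA : Aκ ≤ A := le_trans (by rw [hA₁]; simp) hA
  have hAK : Real.log K ≤ A := le_trans (by rw [hA₁]; simp) hA
  have hAm : (2 * (2 * e : ℕ) + 1 : ℝ) ≤ A := le_trans (by rw [hA₁]; simp) hA
  have hA1 : 1 ≤ A := by linarith only [hA2]
  have hA0 : 0 < A := by linarith only [hA2]
  -- `A^{-c₁} ≤ κ₀`
  have hAc : A ^ (-c₁) ≤ κ₀ := by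
    have h1 : κ₀⁻¹ ≤ A ^ c₁ := by
      calc κ₀⁻¹ = Aκ ^ c₁ := by
            rw [hAκ, ← Real.rpow_mul (inv_nonneg.2 hκ₀.le), one_div_mul_cancel hc₁.ne',
              Real.rpow_one]
        _ ≤ A ^ c₁ := Real.rpow_le_rpow (by rw [hAκ]; positivity) hAκA hc₁.le
    rw [Real.rpow_neg hA0.le]
    exact inv_le_of_inv_le₀ hκ₀ h1
  -- the dyadic scale `2^J ≥ R = max(ΛA, 2 √(exp exp(A^{C₈})))`
  obtain ⟨Tr, hTr⟩ : ∃ Tr : ℝ, Tr = palasekDoubleExp C₈ A := ⟨_, rfl⟩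
  have hTr1 : 1 ≤ Tr := by rw [hTr]; exact one_le_palasekDoubleExp _ _
  have hTr0 : 0 < Tr := by linarith only [hTr1]
  obtain ⟨R, hR⟩ : ∃ R : ℝ, R = max (Λ * A) (2 * Real.sqrt Tr) := ⟨_, rfl⟩
  have hΛA1 : 1 ≤ Λ * A := by nlinarith only [hΛ, hA1]
  have hR1 : 1 ≤ R := by rw [hR]; exact le_max_of_le_left hΛA1
  have hR0 : 0 < R := by linarith only [hR1]
  obtain ⟨J, hJ⟩ : ∃ J : ℤ, J = ⌈Real.logb 2 R⌉ := ⟨_, rfl⟩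
  have h2J : R ≤ (2 : ℝ) ^ J := by
    calc R = (2 : ℝ) ^ Real.logb 2 R := (Real.rpow_logb two_pos (by norm_num) hR0).symm
      _ ≤ (2 : ℝ) ^ ((J : ℤ) : ℝ) := by
          refine Real.rpow_le_rpow_of_exponent_le one_le_two ?_
          rw [hJ]; exact Int.le_ceil _
      _ = (2 : ℝ) ^ J := Real.rpow_intCast 2 J
  have h2J' : (2 : ℝ) ^ J < 2 * R := by
    calc (2 : ℝ) ^ J = (2 : ℝ) ^ ((J : ℤ) : ℝ) := (Real.rpow_intCast 2 J).symm
      _ < (2 : ℝ) ^ (Real.logb 2 R + 1) := by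
          refine Real.rpow_lt_rpow_of_exponent_lt one_lt_two ?_
          rw [hJ]; exact Int.ceil_lt_add_one _
      _ = 2 * R := by
          rw [Real.rpow_add two_pos, Real.rpow_logb two_pos (by norm_num) hR0, Real.rpow_one,
            mul_comm]
  have hΛJ : Λ * A ≤ (2 : ℝ) ^ J := le_trans (by rw [hR]; exact le_max_left _ _) h2J
  have hsqrtJ : 2 * Real.sqrt Tr ≤ (2 : ℝ) ^ J :=
    le_trans (by rw [hR]; exact le_max_right _ _) h2J
  -- (6.1) from the contrapositive of the main estimate on `[0, t]`
  have h61 : ∀ t ∈ Icc (1 / 2 : ℝ) 1, ∀ j : ℤ, J ≤ j → ∀ y,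
      ‖blockFn j (u t) y‖ ≤ κ₀ * (2 : ℝ) ^ j := by
    intro t ht j hj y
    by_contra hlt
    have hlt' : κ₀ * (2 : ℝ) ^ j < ‖blockFn j (u t) y‖ := lt_of_not_ge hlt
    have ht0 : 0 < t := by linarith only [ht.1]
    have hsolt : IsHkClassicalSolutionOn (Icc 0 t) u p :=
      hsol.mono (Icc_subset_Icc_right ht.2) (uniqueDiffOn_Icc ht0)
    have haxt : ∀ s ∈ Icc 0 t, IsAxisymmetric (u s) := fun s hs =>
      hax s ⟨hs.1, hs.2.trans ht.2⟩
    have hA3t : ∀ s ∈ Icc 0 t, eLpNorm (u s) 3 volume ≤ ENNReal.ofReal A := fun s hs =>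
      hA3 s ⟨hs.1, hs.2.trans ht.2⟩
    have hlarge : A ^ (-c₁) * (2 : ℝ) ^ j ≤ ‖blockFn j (u t) y‖ := by
      have : A ^ (-c₁) * (2 : ℝ) ^ j ≤ κ₀ * (2 : ℝ) ^ j :=
        mul_le_mul_of_nonneg_right hAc (zpow_nonneg zero_le_two _)
      exact this.trans hlt'.le
    have hM := hmain t A u p hsolt ht0 haxt hA3t hAA₀ y j hlarge
    -- but `t 4^j ≥ ½ · 4^J ≥ ½ R² ≥ 2 Tr > Tr ≥ exp exp(A^{C₇})`
    have h4j : (4 : ℝ) ^ J ≤ (4 : ℝ) ^ j := zpow_le_zpow_right₀ (by norm_num) hj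
    have h4J : ((2 : ℝ) ^ J) ^ 2 = (4 : ℝ) ^ J := by
      rw [← zpow_natCast, ← zpow_mul, mul_comm, zpow_mul]; norm_num
    have hsq : (2 * Real.sqrt Tr) ^ 2 = 4 * Tr := by
      rw [mul_pow, Real.sq_sqrt hTr0.le]; norm_num
    have hRsq : 4 * Tr ≤ (4 : ℝ) ^ J := by
      rw [← hsq, ← h4J]
      exact pow_le_pow_left₀ (by positivity) hsqrtJ 2
    have hTr7 : palasekDoubleExp C₇ A ≤ Tr := by rw [hTr]; exact palasekDoubleExp_mono hA1 hC₇₈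
    have : t * (4 : ℝ) ^ j ≥ 2 * Tr := by
      calc t * (4 : ℝ) ^ j ≥ 1 / 2 * (4 : ℝ) ^ J := by
            exact mul_le_mul ht.1 h4j (zpow_nonneg (by norm_num) _) ht0.le
        _ ≥ 1 / 2 * (4 * Tr) := by gcongr
        _ = 2 * Tr := by ring
    linarith only [this, hM, hTr7, hTr0]
  -- §6 (Tao's energy method, quoted by Palasek: "conclude exactly as in [tao]")
  obtain ⟨hu1, hDu1⟩ := h6 hsol hA1 hA3 hΛJ h61 x
  -- `A 2^J ≤ 4 Λ A² Tr`
  have hX : A * (2 : ℝ) ^ J ≤ 4 * Λ * A ^ 2 * Tr := by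
    have hsqrt : Real.sqrt Tr ≤ Tr := by
      rw [Real.sqrt_le_left hTr0.le]
      exact le_self_pow₀ hTr1 two_ne_zero
    have h2s1 : 1 ≤ 2 * Real.sqrt Tr := by
      have : 1 ≤ Real.sqrt Tr := by rw [Real.le_sqrt zero_le_one hTr0.le]; simpa using hTr1
      linarith only [this]
    have hRle : R ≤ Λ * A * (2 * Real.sqrt Tr) := by
      rw [hR]
      refine max_le ?_ ?_
      · calc Λ * A = Λ * A * 1 := (mul_one _).symm
          _ ≤ Λ * A * (2 * Real.sqrt Tr) := mul_le_mul_of_nonneg_left h2s1 (by positivity)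
      · calc 2 * Real.sqrt Tr = 1 * (2 * Real.sqrt Tr) := (one_mul _).symm
          _ ≤ Λ * A * (2 * Real.sqrt Tr) := mul_le_mul_of_nonneg_right hΛA1 (by positivity)
    calc A * (2 : ℝ) ^ J ≤ A * (2 * R) := mul_le_mul_of_nonneg_left h2J'.le hA0.le
      _ ≤ A * (2 * (Λ * A * (2 * Real.sqrt Tr))) := by gcongr
      _ ≤ A * (2 * (Λ * A * (2 * Tr))) := by gcongr
      _ = 4 * Λ * A ^ 2 * Tr := by ring
  have hX0 : 0 ≤ A * (2 : ℝ) ^ J := by positivity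
  -- absorb the polynomial into the double exponential
  have hpoly : C₆ * (A * (2 : ℝ) ^ J) ^ e ≤ palasekDoubleExp (C₈ + 1) A := by
    have h1 : C₆ * (A * (2 : ℝ) ^ J) ^ e ≤ K * A ^ (2 * e) * Tr ^ (2 * e) := by
      calc C₆ * (A * (2 : ℝ) ^ J) ^ e ≤ C₆ * (4 * Λ * A ^ 2 * Tr) ^ e := by gcongr
        _ = K * A ^ (2 * e) * Tr ^ e := by rw [hK, pow_mul]; ring
        _ ≤ K * A ^ (2 * e) * Tr ^ (2 * e) := by
            refine mul_le_mul_of_nonneg_left (pow_le_pow_right₀ hTr1 (by omega)) (by positivity)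
    refine h1.trans ?_
    rw [hTr]
    exact palasekDoubleExp_absorb hKpos (2 * e) hC₈1 hA2 hAK (by exact_mod_cast hAm)
  exact ⟨hu1.trans hpoly, hDu1.trans hpoly⟩

end MainEstimate

end Literature.Analysis.FluidPDE

end
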